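import Summits.BirchSwinnertonDyer.BirchSwinnertonDyer.Theorems.ClassRecordThreeEulerHalvesAtThreeCartanSupplyFixedPointsP1
import Mathlib.GroupTheory.Coset.Basic
import Mathlib.GroupTheory.GroupAction.Quotient
import HarnessLib

/-!
# The CUBIC POINTS of `ℙ¹(𝔽_q)`: the coset space `C = GL₂(𝔽_q) ⧸ H`, `H = {(a b; 0 d) : a/d a cube}`, and the fixed points of `g` on it

Helper file `--supports stmt-BirchSwinnertonDyer-23422` (seat `bsd-stepL-tam3-p1` g23, LINE OWNER of crux 23422 `EulerHalvesAtThreeResidualUpperBound`,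
line `cartan` v11), serving the registered stub (SUPPLY) `stub_cartanTorusLatticeSupply : CartanCorrespondence.CartanTorusLatticeSupply` via
`HOME/tam3-p1/g23/SUPPLY-ROAD-GG1.md` §1–§2 (principal-series places `q ≡ 1 (3)`): the lattice `V₁ = ker(ℤ[C] → ℤ[ℙ¹])` has character
`π_C − π_{ℙ¹} = 2χ_W`, and `C` carries the Hecke operators of the structural road. THIS FILE:
* §1 `cubicBorel q : Subgroup (GL₂(𝔽_q))` — upper-triangular matrices whose diagonal ratio `g₀₀/g₁₁` is a cube (`∃ u, u³ g₁₁ = g₀₀`); the cubic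
  points are the cosets `GL₂(𝔽_q) ⧸ cubicBorel q` with the left action (Mathlib's `MulAction.quotient`).
* §2 (generic, any group) `natCard_conj_mem_eq`: `#{x : x⁻¹ g x ∈ H} = #H · #Fix(g, Γ ⧸ H)`.
* §3 `inv_mul_mul_mem_cubicBorel_iff`: `x⁻¹ g x ∈ H ⟺` the first column `v` of `x` is an eigenvector of `g`, `g v = a v`, with `a² / det g` a cube
  (`∃ u, u³ det g = a²`) — so the fixed points of `g` on `C` are counted by EIGENVECTORS (next file: `3(q+1) ∣ 3 ∣ 6·[λ/μ cube] ∣ 0` by type).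
HONEST FRAMING: finite-group bookkeeping; nothing about SUPPLY, NUM, crux 23422 ∕ 19109 is proved here; BSD is proved for no curve. [folklore]
-/

namespace Summit.BirchSwinnertonDyer.BirchSwinnertonDyer.Theorems.CartanSupply.CubicPoints

open Summit.BirchSwinnertonDyer.BirchSwinnertonDyer.Theorems.CartanDegree
open Summit.BirchSwinnertonDyer.BirchSwinnertonDyer.Theorems.CartanTorusCubeCut

set_option linter.dupNamespace false
set_option autoImplicit false

section generic

/-! ## §2 Fixed points on a coset space (any group) -/

variable {Γ : Type*} [Group Γ]

/-- PROVED: `x⁻¹ g x ∈ H` iff the coset `xH` is fixed by `g`. [folklore] -/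
theorem inv_mul_mul_mem_iff_smul_eq (H : Subgroup Γ) (g x : Γ) :
    x⁻¹ * g * x ∈ H ↔ g • (QuotientGroup.mk x : Γ ⧸ H) = QuotientGroup.mk x := by
  rw [MulAction.Quotient.smul_mk, eq_comm, QuotientGroup.eq, smul_eq_mul, mul_assoc]

/-- PROVED — **FIXED POINTS ON `Γ ⧸ H`**: `#{x ∈ Γ : x⁻¹ g x ∈ H} = #H · #{c ∈ Γ ⧸ H : g • c = c}` (the preimage of the fixed set under
`Γ → Γ ⧸ H` is a union of cosets). [folklore] -/
theorem natCard_conj_mem_eq (H : Subgroup Γ) (g : Γ) :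
    Nat.card {x : Γ // x⁻¹ * g * x ∈ H} = Nat.card H * Nat.card {c : Γ ⧸ H // g • c = c} := by
  let T : Set (Γ ⧸ H) := {c | g • c = c}
  have hpre : {x : Γ | x⁻¹ * g * x ∈ H} = QuotientGroup.mk ⁻¹' T := by
    ext x
    simp only [Set.mem_setOf_eq, Set.mem_preimage, T]
    exact inv_mul_mul_mem_iff_smul_eq H g x
  have e := QuotientGroup.preimageMkEquivSubgroupProdSet H T
  rw [← hpre] at e
  have h1 : Nat.card {x : Γ // x⁻¹ * g * x ∈ H} = Nat.card (H × T) := Nat.card_congr e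
  rw [h1, Nat.card_prod]
  rfl

end generic

/-! ## §1 The cubic Borel subgroup -/

variable {q : ℕ} [Fact q.Prime]

/-- PROVED: an invertible upper-triangular `2 × 2` matrix has non-zero diagonal entries. [folklore] -/
theorem diag_ne_zero_of_upper (g : G q) (h10 : (g : Mat q) 1 0 = 0) : (g : Mat q) 0 0 ≠ 0 ∧ (g : Mat q) 1 1 ≠ 0 := by
  have hdet : (g : Mat q).det ≠ 0 := by
    rw [← Matrix.GeneralLinearGroup.val_det_apply]
    exact (Matrix.GeneralLinearGroup.det g).ne_zero
  rw [Matrix.det_fin_two, h10, mul_zero, sub_zero] at hdet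
  exact ⟨left_ne_zero_of_mul hdet, right_ne_zero_of_mul hdet⟩

/-- PROVED: entries of a product with an upper-triangular factor. [folklore] -/
theorem mul_entries (g h : G q) :
    ((g * h : G q) : Mat q) 1 0 = (g : Mat q) 1 0 * (h : Mat q) 0 0 + (g : Mat q) 1 1 * (h : Mat q) 1 0 ∧
    ((g * h : G q) : Mat q) 0 0 = (g : Mat q) 0 0 * (h : Mat q) 0 0 + (g : Mat q) 0 1 * (h : Mat q) 1 0 ∧
    ((g * h : G q) : Mat q) 1 1 = (g : Mat q) 1 0 * (h : Mat q) 0 1 + (g : Mat q) 1 1 * (h : Mat q) 1 1 := by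
  refine ⟨?_, ?_, ?_⟩ <;> rw [Units.val_mul, Matrix.mul_apply, Fin.sum_univ_two]

/-- **The cubic Borel subgroup** `H = {(a b; 0 d) ∈ GL₂(𝔽_q) : a/d is a cube}` (the stabiliser of a cubic point; index 3 in the Borel subgroup
when `q ≡ 1 (mod 3)`, equal to it otherwise). -/
def cubicBorel (q : ℕ) [Fact q.Prime] : Subgroup (G q) where
  carrier := {g | (g : Mat q) 1 0 = 0 ∧ ∃ u : ZMod q, u ^ 3 * (g : Mat q) 1 1 = (g : Mat q) 0 0}
  mul_mem' := by
    rintro g h ⟨hg0, u, hu⟩ ⟨hh0, v, hv⟩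
    obtain ⟨e10, e00, e11⟩ := mul_entries g h
    refine ⟨by rw [e10, hg0, hh0, zero_mul, mul_zero, add_zero], u * v, ?_⟩
    rw [e00, e11, hg0, hh0, mul_zero, add_zero, zero_mul, zero_add, ← hu, ← hv]
    ring
  one_mem' := by
    refine ⟨by simp, 1, ?_⟩
    simp
  inv_mem' := by
    rintro g ⟨hg0, u, hu⟩
    obtain ⟨hg00, hg11⟩ := diag_ne_zero_of_upper g hg0
    -- entries of `g⁻¹` from `g⁻¹ * g = 1`
    obtain ⟨e10, e00, e11⟩ := mul_entries g⁻¹ g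
    rw [inv_mul_cancel, Units.val_one] at e10 e00 e11
    rw [Matrix.one_apply_ne (by decide), hg0, mul_zero, add_zero] at e10
    have hi10 : ((g⁻¹ : G q) : Mat q) 1 0 = 0 := by
      rcases mul_eq_zero.mp e10.symm with h | h
      · exact h
      · exact absurd h hg00
    rw [Matrix.one_apply_eq, hg0, mul_zero, add_zero] at e00
    rw [Matrix.one_apply_eq, hi10, zero_mul, zero_add] at e11
    have hu0 : u ≠ 0 := by
      rintro rfl
      apply hg00
      rw [← hu]; ring
    refine ⟨hi10, u⁻¹, ?_⟩
    -- `u⁻³ (g⁻¹)₁₁ = (g⁻¹)₀₀`  ⟸  `(g⁻¹)₀₀ g₀₀ = 1 = (g⁻¹)₁₁ g₁₁` and `u³ g₁₁ = g₀₀`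
    have key : u ^ 3 * (((g⁻¹ : G q) : Mat q) 0 0 * (g : Mat q) 1 1) = ((g⁻¹ : G q) : Mat q) 1 1 * (g : Mat q) 1 1 := by
      rw [← e11]
      calc u ^ 3 * (((g⁻¹ : G q) : Mat q) 0 0 * (g : Mat q) 1 1)
          = ((g⁻¹ : G q) : Mat q) 0 0 * (u ^ 3 * (g : Mat q) 1 1) := by ring
        _ = 1 := by rw [hu, ← e00]
    have key' : u ^ 3 * ((g⁻¹ : G q) : Mat q) 0 0 = ((g⁻¹ : G q) : Mat q) 1 1 :=
      mul_right_cancel₀ hg11 (by rw [mul_assoc]; exact key)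
    rw [← key']
    field_simp

/-- PROVED: membership in the cubic Borel subgroup. [folklore] -/
theorem mem_cubicBorel_iff (g : G q) :
    g ∈ cubicBorel q ↔ (g : Mat q) 1 0 = 0 ∧ ∃ u : ZMod q, u ^ 3 * (g : Mat q) 1 1 = (g : Mat q) 0 0 := Iff.rfl

/-! ## §3 Conjugates in `H` and eigenvectors -/

/-- PROVED: the first column of `x m` is `x` applied to the first column of `m`; if `m₁₀ = 0` it is `m₀₀` times the first column of `x`.
[folklore] -/
theorem mulVec_col_eq_of_entry10 (x m : Mat q) (hm : m 1 0 = 0) :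
    (x * m).mulVec (Pi.single 0 1) = m 0 0 • x.mulVec (Pi.single 0 1) := by
  ext i
  simp [Matrix.mul_apply, Matrix.mulVec, dotProduct, Fin.sum_univ_two, hm]
  ring

/-- PROVED — **CONJUGATES AND EIGENVECTORS**: `x⁻¹ g x` is upper-triangular iff the first column `v = x e₀` of `x` is an eigenvector of `g`;
then `(x⁻¹ g x)₀₀` is the eigenvalue `a` and `(x⁻¹ g x)₁₁ = det g / a`. Precisely: `x⁻¹ g x ∈ cubicBorel q ⟺ ∃ a, g v = a v ∧ ∃ u, u³ det g = a²`.
[folklore] -/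
theorem inv_mul_mul_mem_cubicBorel_iff (g x : G q) :
    x⁻¹ * g * x ∈ cubicBorel q ↔
      ∃ a : ZMod q, (g : Mat q).mulVec ((x : Mat q).mulVec (Pi.single 0 1)) = a • (x : Mat q).mulVec (Pi.single 0 1) ∧
        ∃ u : ZMod q, u ^ 3 * (g : Mat q).det = a ^ 2 := by
  set m : G q := x⁻¹ * g * x with hm
  have hxm : (x : Mat q) * (m : Mat q) = (g : Mat q) * (x : Mat q) := by
    rw [← Units.val_mul, hm, ← mul_assoc, ← mul_assoc, mul_inv_cancel, one_mul, Units.val_mul]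
  have hdetm : (m : Mat q).det = (g : Mat q).det := by
    rw [hm, Units.val_mul, Units.val_mul]
    exact Matrix.det_units_conj' x (g : Mat q)
  -- the first column of `x m` vs `g x`
  have hcol : (x : Mat q).mulVec ((m : Mat q).mulVec (Pi.single 0 1)) =
      (g : Mat q).mulVec ((x : Mat q).mulVec (Pi.single 0 1)) := by
    rw [Matrix.mulVec_mulVec, Matrix.mulVec_mulVec, hxm]
  have col_apply : ∀ (M : Mat q) (i : Fin 2), M.mulVec (Pi.single 0 1) i = M i 0 := fun M i => by
    simp [Matrix.mulVec, dotProduct, Pi.single_apply]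
  -- `x` is injective on vectors
  have hxinj : ∀ v w : Fin 2 → ZMod q, (x : Mat q).mulVec v = (x : Mat q).mulVec w → v = w := fun v w h => by
    have := congrArg (((x⁻¹ : G q) : Mat q).mulVec) h
    rwa [Matrix.mulVec_mulVec, Matrix.mulVec_mulVec, ← Units.val_mul, inv_mul_cancel, Units.val_one, Matrix.one_mulVec,
      Matrix.one_mulVec] at this
  constructor
  · rintro ⟨h10, u, hu⟩
    obtain ⟨h00, h11⟩ := diag_ne_zero_of_upper m h10
    refine ⟨(m : Mat q) 0 0, ?_, u, ?_⟩
    · rw [← hcol, Matrix.mulVec_mulVec, mulVec_col_eq_of_entry10 _ _ h10]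
    · have hdet' : (m : Mat q).det = (m : Mat q) 0 0 * (m : Mat q) 1 1 := by
        rw [Matrix.det_fin_two, h10, mul_zero, sub_zero]
      rw [← hdetm, hdet', ← hu]
      ring
  · rintro ⟨a, ha, u, hu⟩
    -- `m e₀ = a e₀`
    have hme : (m : Mat q).mulVec (Pi.single 0 1) = a • (Pi.single 0 1 : Fin 2 → ZMod q) := by
      apply hxinj
      rw [hcol, ha, Matrix.mulVec_smul]
    have h10 : (m : Mat q) 1 0 = 0 := by
      have := congrFun hme 1
      rw [col_apply] at this
      simpa using this
    have h00 : (m : Mat q) 0 0 = a := by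
      have := congrFun hme 0
      rw [col_apply] at this
      simpa using this
    obtain ⟨ha0, h11⟩ := diag_ne_zero_of_upper m h10
    rw [h00] at ha0
    refine ⟨h10, u, ?_⟩
    have hdet' : (g : Mat q).det = a * (m : Mat q) 1 1 := by
      rw [← hdetm, Matrix.det_fin_two, h10, mul_zero, sub_zero, h00]
    rw [h00]
    apply mul_left_cancel₀ ha0
    calc a * (u ^ 3 * (m : Mat q) 1 1) = u ^ 3 * (a * (m : Mat q) 1 1) := by ring
      _ = u ^ 3 * (g : Mat q).det := by rw [hdet']
      _ = a ^ 2 := hu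
      _ = a * a := sq a

end Summit.BirchSwinnertonDyer.BirchSwinnertonDyer.Theorems.CartanSupply.CubicPoints
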